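import Literature.MathematicalPhysics.QuantumLattice.DWaveSourceProofs
import Literature.MathematicalPhysics.QuantumLattice.BdGBondHamiltonianTorus
import Literature.MathematicalPhysics.QuantumLattice.PairCorrelationsODLROSupRayleighProofs

/-!
# Seed leverage for crux `TwSeededEnsembleEquivalence` (stmt-HubbardSuperconductivity-1698)

Negative-side support lemmas (refuter, cdisprove gen 2), sorry-free: how far the mean-field d-wave
seed `−(g/L²) Δ_dᴴ Δ_d` of route `ThermalWedge` can move a Rayleigh quotient of the repulsive
Hubbard torus. `‖Δ_d‖² ≤ 32 L⁴` (`norm_pairField_le` with the constant `(4√2)² = 32` evaluated),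
`0 ≤ Re⟨ψ, Δᴴ Δ ψ⟩ ≤ ‖Δ_d‖²` on unit vectors, hence
`0 ≤ Re⟨ψ, H₀ ψ⟩ − Re⟨ψ, (H₀ − (g/L²)ΔᴴΔ) ψ⟩ ≤ 32 g L²`: every energy density of the seeded model
is within `32 g` of the pure one, so the convexity content of the crux beyond the (automatically
convex) short-range model is a mean-field perturbation of size ≤ 64 g per site.
See `Cruxes/TwSeededEnsembleEquivalence/Disproof.lean`.
-/

namespace Summit.HubbardSuperconductivity.HubbardSuperconductivity.Theorems.TwSeededEnsembleEquivalence.Negative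

open Matrix Literature.MathematicalPhysics.QuantumLattice
open scoped ComplexOrder Matrix.Norms.L2Operator

noncomputable section

/-! ### Seed leverage — how far the mean-field seed can move any Rayleigh quotient -/

/-- `0 ≤ Re⟨ψ, P ψ⟩` (`P = ΔᴴΔ ≥ 0`). -/
theorem re_rayleigh_seed_nonneg (L : ℕ) [NeZero L] (ψ : Fock (Orb (FermionTorus 2 L))) :
    0 ≤ (star ψ ⬝ᵥ ((pairField dWaveFormFactor L)ᴴ * pairField dWaveFormFactor L) *ᵥ ψ).re := by
  have h := (pairField_conjTranspose_mul_self_posSemidef dWaveFormFactor L).re_dotProduct_nonneg ψ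
  simpa using h

/-- `Re⟨ψ, P ψ⟩ ≤ ‖Δ_d‖²` for a unit vector (Cauchy–Schwarz and the C⋆-identity `‖ΔᴴΔ‖ = ‖Δ‖²`
for the `ℓ²`-operator norm). -/
theorem re_rayleigh_seed_le (L : ℕ) [NeZero L] {ψ : Fock (Orb (FermionTorus 2 L))}
    (hψ : star ψ ⬝ᵥ ψ = 1) :
    (star ψ ⬝ᵥ ((pairField dWaveFormFactor L)ᴴ * pairField dWaveFormFactor L) *ᵥ ψ).re ≤ ‖pairField dWaveFormFactor L‖ ^ 2 := by
  have h := re_star_dotProduct_mulVec_le_opNorm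
    ((pairField dWaveFormFactor L)ᴴ * pairField dWaveFormFactor L) hψ
  rw [← Matrix.cstar_norm_def, Matrix.l2_opNorm_conjTranspose_mul_self, ← sq] at h
  exact h

/-- The numerical constant of `norm_pairField_le` for the `d`-wave form factor:
`(2 Σ_{e ∈ {0,±e₁,±e₂}} |d(e)/√2|)² = (4√2)² = 32`. -/
theorem dWave_norm_const_sq :
    (2 * ∑ e ∈ insert (0 : Literature.Probability.LatticeModels.Site 2) unitSteps,
        |dWaveFormFactor e / Real.sqrt 2|) ^ 2 = 32 := by
  rw [Finset.sum_insert zero_not_mem_unitSteps, sum_unitSteps, dWaveFormFactor_zero,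
    dWaveFormFactor_neg, dWaveFormFactor_neg, dWaveFormFactor_unitStep, dWaveFormFactor_unitStep]
  simp only [Fin.one_eq_zero_iff, if_true, OfNat.ofNat_ne_one, if_false, zero_div, abs_zero, zero_add]
  have hs : 0 < Real.sqrt 2 := Real.sqrt_pos.2 (by norm_num)
  have h2 : Real.sqrt 2 ^ 2 = 2 := Real.sq_sqrt (by norm_num)
  rw [abs_of_pos (div_pos one_pos hs), abs_of_neg (by rw [neg_div]; exact neg_neg_of_pos (div_pos one_pos hs))]
  field_simp
  nlinarith [h2]

/-- `‖Δ_d‖² ≤ 32 L⁴`. -/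
theorem norm_pairField_sq_le (L : ℕ) [NeZero L] :
    ‖pairField dWaveFormFactor L‖ ^ 2 ≤ 32 * ((L : ℝ) ^ 2) ^ 2 := by
  have h := norm_pairField_le dWaveFormFactor L
  have h0 : 0 ≤ ‖pairField dWaveFormFactor L‖ := norm_nonneg _
  calc ‖pairField dWaveFormFactor L‖ ^ 2
      ≤ ((2 * ∑ e ∈ insert (0 : Literature.Probability.LatticeModels.Site 2) unitSteps,
          |dWaveFormFactor e / Real.sqrt 2|) * (L : ℝ) ^ 2) ^ 2 :=
        pow_le_pow_left₀ h0 h 2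
    _ = 32 * ((L : ℝ) ^ 2) ^ 2 := by rw [mul_pow, dWave_norm_const_sq]

/-- **Seed leverage, pointwise**: `Re⟨ψ, Hcan ψ⟩ = Re⟨ψ, H₀ ψ⟩ − (g/L²) Re⟨ψ, P ψ⟩` with
`H₀ = hubbardTorus 2 L 1 U` the PURE repulsive Hubbard torus. -/
theorem re_rayleigh_Hcan_eq (L : ℕ) [NeZero L] (U g : ℝ) (ψ : Fock (Orb (FermionTorus 2 L))) :
    (star ψ ⬝ᵥ (hubbardTorus 2 L 1 U - ((g / (L : ℝ) ^ 2 : ℝ) : ℂ) • ((pairField dWaveFormFactor L)ᴴ * pairField dWaveFormFactor L)) *ᵥ ψ).re =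
      (star ψ ⬝ᵥ hubbardTorus 2 L 1 U *ᵥ ψ).re - g / (L : ℝ) ^ 2 * (star ψ ⬝ᵥ ((pairField dWaveFormFactor L)ᴴ * pairField dWaveFormFactor L) *ᵥ ψ).re := by
  simp only [sub_mulVec, smul_mulVec, dotProduct_sub, dotProduct_smul, Complex.sub_re,
    smul_eq_mul, Complex.re_ofReal_mul]

/-- The seed never RAISES a Rayleigh quotient (`g ≥ 0`): `Re⟨ψ,Hcan ψ⟩ ≤ Re⟨ψ,H₀ ψ⟩`. -/
theorem re_rayleigh_Hcan_le_pure (L : ℕ) [NeZero L] {U g : ℝ} (hg : 0 ≤ g)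
    (ψ : Fock (Orb (FermionTorus 2 L))) :
    (star ψ ⬝ᵥ (hubbardTorus 2 L 1 U - ((g / (L : ℝ) ^ 2 : ℝ) : ℂ) • ((pairField dWaveFormFactor L)ᴴ * pairField dWaveFormFactor L)) *ᵥ ψ).re ≤ (star ψ ⬝ᵥ hubbardTorus 2 L 1 U *ᵥ ψ).re := by
  rw [re_rayleigh_Hcan_eq]
  have h1 := re_rayleigh_seed_nonneg L ψ
  have h2 : 0 ≤ g / (L : ℝ) ^ 2 := div_nonneg hg (sq_nonneg _)
  nlinarith

/-- ... and LOWERS it by at most `32 g L²` on unit vectors: `Re⟨ψ,H₀ψ⟩ ≤ Re⟨ψ,Hcan ψ⟩ + 32 g L²`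
(`‖Δ_d‖ ≤ 4√2 L²`). So every energy DENSITY of the seeded model is within `32 g ≤ 3.2` of the pure
one: the crux's convexity content beyond the pure (short-range, automatically convex) model is a
perturbation of size ≤ 64 g per site. -/
theorem re_rayleigh_pure_le_Hcan_add (L : ℕ) [NeZero L] {U g : ℝ} (hg : 0 ≤ g)
    {ψ : Fock (Orb (FermionTorus 2 L))} (hψ : star ψ ⬝ᵥ ψ = 1) :
    (star ψ ⬝ᵥ hubbardTorus 2 L 1 U *ᵥ ψ).re ≤
      (star ψ ⬝ᵥ (hubbardTorus 2 L 1 U - ((g / (L : ℝ) ^ 2 : ℝ) : ℂ) • ((pairField dWaveFormFactor L)ᴴ * pairField dWaveFormFactor L)) *ᵥ ψ).re + 32 * g * (L : ℝ) ^ 2 := by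
  rw [re_rayleigh_Hcan_eq]
  have hL : (0 : ℝ) < (L : ℝ) ^ 2 := cast_sq_pos_of_neZero L
  have h1 : (star ψ ⬝ᵥ ((pairField dWaveFormFactor L)ᴴ * pairField dWaveFormFactor L) *ᵥ ψ).re ≤ 32 * ((L : ℝ) ^ 2) ^ 2 :=
    (re_rayleigh_seed_le L hψ).trans (norm_pairField_sq_le L)
  have h2 : g / (L : ℝ) ^ 2 * (star ψ ⬝ᵥ ((pairField dWaveFormFactor L)ᴴ * pairField dWaveFormFactor L) *ᵥ ψ).re ≤ g / (L : ℝ) ^ 2 * (32 * ((L : ℝ) ^ 2) ^ 2) :=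
    mul_le_mul_of_nonneg_left h1 (div_nonneg hg hL.le)
  have h3 : g / (L : ℝ) ^ 2 * (32 * ((L : ℝ) ^ 2) ^ 2) = 32 * g * (L : ℝ) ^ 2 := by
    field_simp
  linarith

end

end Summit.HubbardSuperconductivity.HubbardSuperconductivity.Theorems.TwSeededEnsembleEquivalence.Negative
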